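import Summits.AnomalousDissipation.AnomalousDissipation.Theorems.WindLineWindyGalerkinSteadyZerothLawBaireBirth
import Summits.AnomalousDissipation.AnomalousDissipation.Theorems.CoherentStatesSteadyImpliesCoherent

/-!
# The Baire birth of line `registered` also feeds route CoherentStates (cross-route edge of crux stmt-AnomalousDissipation-11414)

Support file for crux `WindLine.WindyGalerkinSteadyZerothLaw` (stmt-AnomalousDissipation-11414).  The landed glue
`loudNondegenerateSteadyStates_of_robust` / `denseRobustNondegenerateLoud_of_dense` (`…BaireBirth.lean`, p150591) turns the line's
four registered stubs A (dense loud steady designer forces over the Baire space `𝒜 ⊆ SymL2 (Fin 3)`), B (generic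
leaf-nondegeneracy), O (openness of the nondegenerate-loud sets; LANDED p151720) and D (force dictionary; LANDED p149945) into the
HEART — loud, bounded, leaf-nondegenerate classical steady states of `NS_{ν_j}(f)` along `ν_j → 0⁺` for one smooth force.  Forgetting
nondegeneracy, the heart is VERBATIM the open crux `CoherentStates.SteadyZerothLaw` (stmt-AnomalousDissipation-0219) — a steady
classical state is `Torus.IsSteadyNSState = IsClassicalNSSolutionOn univ` on constant data, and strict budgets give the non-strict ones
— so the same two open statements A ∧ B close, by name and kernel-checked: `SteadyZerothLaw` (`steadyZerothLaw_of_baireBirth`), hence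
`CoherentThesis` (landed `steadyImpliesCoherent_proof`, stmt-0265) and the summit statement (`CoherentStates.closes`, rendered in the
route file) — `coherentThesis_of_baireBirth`, `anomalousDissipation_of_baireBirth`.  All hypotheses inline; nothing is assumed about
X, 0219 or the summit.

References: route files `Theses/WindLine.lean`, `Theses/CoherentStates.lean`; skeleton `Cruxes/WindyGalerkinSteadyZerothLaw/Lines/birth.lean`
(rev 5c); Foias–Temam 1976/77/78 (generic regularity), Simon 1995 (Baire–Osgood transfer).
-/

noncomputable section

-- D-0017: single-problem summit ⇒ the duplicated namespace segment is by design.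
set_option linter.dupNamespace false

open scoped InnerProductSpace Topology ComplexConjugate
open MeasureTheory Filter UnitAddTorus Set
open Literature.Analysis.FunctionSpaces Literature.Analysis.FunctionSpaces.Torus
open Literature.Analysis.FunctionSpaces.EuclideanSpace
open Literature.Analysis.FluidPDE Literature.Analysis.FluidPDE.Torus

namespace Summit.AnomalousDissipation.AnomalousDissipation.Theorems.WindLineWindyGalerkinSteadyZerothLaw

/-- The flat three-torus (local notation). -/
local notation "𝕋³" => UnitAddTorus (Fin 3)
/-- Velocity values (local notation). -/
local notation "E³" => EuclideanSpace ℝ (Fin 3)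
set_option quotPrecheck false in
/-- **The admissible parameter set** `𝒜 ⊆ SymL2 (Fin 3)` (local notation; used as the TYPE `↥𝒜` of parameters). -/
local notation "𝒜" => ({c : SymL2 (Fin 3) | c 0 = 0 ∧
  ∀ k : Fin 3 → ℤ, ∑ j : Fin 3, ((k j : ℤ) : ℂ) * c k j = 0} : Set (SymL2 (Fin 3)))
/-- **The force of a parameter** (Gaussian-damped synthesis; local notation). -/
local notation "F⟦" c "⟧" => SymL2.field (fun k : Fin 3 → ℤ => Real.exp (freqNormSq k)) (c : SymL2 (Fin 3))

/-- **A → B → O → D → `CoherentStates.SteadyZerothLaw` (stmt-AnomalousDissipation-0219) BY NAME.**  The heart produced by the Baire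
birth (`loudNondegenerateSteadyStates_of_robust ∘ denseRobustNondegenerateLoud_of_dense`) gives, level by level (choice), classical
steady states `u_j, p_j` of `NS_{ν_j}(f)` for ONE smooth divergence-free mean-zero `f`, with `∫|u_j|² < E` and `ε < ν_j‖∇u_j‖²`;
`IsSteadyNSState` unfolds to `IsClassicalNSSolutionOn univ` on constant data and the strict budgets are weakened to `≤`. -/
theorem steadyZerothLaw_of_baireBirth :
    (∃ (ν : ℕ → ℝ) (m : ℕ → E³) (E ε : ℝ), (∀ j, 0 < ν j) ∧ Tendsto ν atTop (𝓝 0) ∧ 0 < ε ∧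
      ∃ U : Set 𝒜, IsOpen U ∧ U.Nonempty ∧
        ∀ j, U ⊆ closure {c : 𝒜 | ∃ (u : 𝕋³ → E³) (p : 𝕋³ → ℝ),
          IsSteadyNSState (ν j) F⟦c⟧ u p ∧ ∫ x, u x = m j ∧
            ∫ x, ‖u x‖ ^ 2 < E ∧ ε < ν j * gradNormSq u}) →
    (∀ (ν : ℝ) (m : E³), 0 < ν →
      Dense (interior {c : 𝒜 | ∀ (u : 𝕋³ → E³) (p : 𝕋³ → ℝ),
        IsSteadyNSState ν F⟦c⟧ u p → ∫ x, u x = m → ¬ IsLinNSEigenvalue ν u 0})) →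
    (∀ (ν : ℝ) (m : E³) (E ε : ℝ), 0 < ν →
      IsOpen {c : 𝒜 | ∃ (u : 𝕋³ → E³) (p : 𝕋³ → ℝ),
        IsSteadyNSState ν F⟦c⟧ u p ∧ ∫ x, u x = m ∧ ¬ IsLinNSEigenvalue ν u 0 ∧
          ∫ x, ‖u x‖ ^ 2 < E ∧ ε < ν * gradNormSq u}) →
    (∀ c : 𝒜, IsSmooth F⟦c⟧ ∧ IsDivFree F⟦c⟧ ∧ HasZeroMean F⟦c⟧) →
    Summit.AnomalousDissipation.AnomalousDissipation.Theses.CoherentStates.SteadyZerothLaw := by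
  intro hA hB hO hD
  obtain ⟨f, hf, hdf, hmf, ν, E, ε, hν, hν0, hε, hH⟩ :=
    loudNondegenerateSteadyStates_of_robust hD (denseRobustNondegenerateLoud_of_dense hA hB hO)
  choose u p hst _hnd hE hεu using hH
  exact ⟨f, hf, hdf, hmf, ν, u, p, hν, hν0, fun j => hst j, ⟨E, fun j => (hE j).le⟩, ε, hε, fun j => (hεu j).le⟩

/-- **A → B → O → D → `CoherentStates.CoherentThesis` (stmt-AnomalousDissipation-0218)**, through the landed
`steadyImpliesCoherent_proof` (stmt-0265: steady classical states are time-periodic classical solutions whose period means are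
`∫|u|²` and `ν‖∇u‖²`). -/
theorem coherentThesis_of_baireBirth :
    (∃ (ν : ℕ → ℝ) (m : ℕ → E³) (E ε : ℝ), (∀ j, 0 < ν j) ∧ Tendsto ν atTop (𝓝 0) ∧ 0 < ε ∧
      ∃ U : Set 𝒜, IsOpen U ∧ U.Nonempty ∧
        ∀ j, U ⊆ closure {c : 𝒜 | ∃ (u : 𝕋³ → E³) (p : 𝕋³ → ℝ),
          IsSteadyNSState (ν j) F⟦c⟧ u p ∧ ∫ x, u x = m j ∧
            ∫ x, ‖u x‖ ^ 2 < E ∧ ε < ν j * gradNormSq u}) →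
    (∀ (ν : ℝ) (m : E³), 0 < ν →
      Dense (interior {c : 𝒜 | ∀ (u : 𝕋³ → E³) (p : 𝕋³ → ℝ),
        IsSteadyNSState ν F⟦c⟧ u p → ∫ x, u x = m → ¬ IsLinNSEigenvalue ν u 0})) →
    (∀ (ν : ℝ) (m : E³) (E ε : ℝ), 0 < ν →
      IsOpen {c : 𝒜 | ∃ (u : 𝕋³ → E³) (p : 𝕋³ → ℝ),
        IsSteadyNSState ν F⟦c⟧ u p ∧ ∫ x, u x = m ∧ ¬ IsLinNSEigenvalue ν u 0 ∧
          ∫ x, ‖u x‖ ^ 2 < E ∧ ε < ν * gradNormSq u}) →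
    (∀ c : 𝒜, IsSmooth F⟦c⟧ ∧ IsDivFree F⟦c⟧ ∧ HasZeroMean F⟦c⟧) →
    Summit.AnomalousDissipation.AnomalousDissipation.Theses.CoherentStates.CoherentThesis :=
  fun hA hB hO hD => Theorems.steadyImpliesCoherent_proof (steadyZerothLaw_of_baireBirth hA hB hO hD)

/-- **A → B → O → D → `AnomalousDissipation`** (the summit statement, by name, CONDITIONALLY on the two open stubs A, B and the two landed
ones O, D), through `CoherentStates.closes` (each global classical solution is a global Leray–Hopf solution from its time-zero slice).
This is the kernel-checked form of "A ∧ B decide the summit" recorded in the line's status; it credits nothing to any item. -/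
theorem anomalousDissipation_of_baireBirth :
    (∃ (ν : ℕ → ℝ) (m : ℕ → E³) (E ε : ℝ), (∀ j, 0 < ν j) ∧ Tendsto ν atTop (𝓝 0) ∧ 0 < ε ∧
      ∃ U : Set 𝒜, IsOpen U ∧ U.Nonempty ∧
        ∀ j, U ⊆ closure {c : 𝒜 | ∃ (u : 𝕋³ → E³) (p : 𝕋³ → ℝ),
          IsSteadyNSState (ν j) F⟦c⟧ u p ∧ ∫ x, u x = m j ∧
            ∫ x, ‖u x‖ ^ 2 < E ∧ ε < ν j * gradNormSq u}) →
    (∀ (ν : ℝ) (m : E³), 0 < ν →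
      Dense (interior {c : 𝒜 | ∀ (u : 𝕋³ → E³) (p : 𝕋³ → ℝ),
        IsSteadyNSState ν F⟦c⟧ u p → ∫ x, u x = m → ¬ IsLinNSEigenvalue ν u 0})) →
    (∀ (ν : ℝ) (m : E³) (E ε : ℝ), 0 < ν →
      IsOpen {c : 𝒜 | ∃ (u : 𝕋³ → E³) (p : 𝕋³ → ℝ),
        IsSteadyNSState ν F⟦c⟧ u p ∧ ∫ x, u x = m ∧ ¬ IsLinNSEigenvalue ν u 0 ∧
          ∫ x, ‖u x‖ ^ 2 < E ∧ ε < ν * gradNormSq u}) →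
    (∀ c : 𝒜, IsSmooth F⟦c⟧ ∧ IsDivFree F⟦c⟧ ∧ HasZeroMean F⟦c⟧) →
    _root_.AnomalousDissipation :=
  fun hA hB hO hD =>
    Summit.AnomalousDissipation.AnomalousDissipation.Theses.CoherentStates.closes (coherentThesis_of_baireBirth hA hB hO hD)

end Summit.AnomalousDissipation.AnomalousDissipation.Theorems.WindLineWindyGalerkinSteadyZerothLaw

end
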